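import Summits.BirchSwinnertonDyer.Rank1Residual.P2.CMKolyvaginCMIsogenyAtTwoSelmer
import Summits.BirchSwinnertonDyer.BirchSwinnertonDyer.Theorems.CMKolyvaginAtInertTwoInertOrderSplittingTower
import HarnessLib

/-!
# `P2` typed interface (cell `bsd-print-cf2`, seat ty2): the EXACT SELMER SPLITTING OVER THE TOWER
# `ℚ ⊂ K ⊂ L` of the Morita frame on `H₂`, with NO displayed binder

Route `CMKolyvaginAtInertTwo`, crux `CMKolyvaginExactAtInertTwo` (stmt-BirchSwinnertonDyer-24277);
MEMO `Cruxes/CMExactDescentAtTwo/MEMO-inert-order-splitting.md` §§3–5. THEOREMS ONLY (0 defs / 0 facts /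
0 sorry); no item is closed; BSD is not proved by this.

cmk2-p1 g10's `InertOrderSplittingHabitat.natCard_selmer_eq_sq_of_tower` (p651904) proves
`#Sel_{2^M}(E_L/L) = (#Sel_{2^M}(E_L/L)^{σ})²` for `E ∈ H₂`, `K` imaginary quadratic, `L ⊇ K` quadratic
over `K`, normal over `ℚ`, totally complex, `√d_F ∈ L`, `σ` = complex conjugation of `L`, GRANTED the
displayed input `hloc` («every `Γ_L`-equivariant CM generator on `E_L(L̄)` has local points maps»). With
ty2's `CMIsogenyAtTwo.natCard_selmer_eq_sq` (p656537: the generator is a `K`-isogeny, which has local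
points maps) the same composition gives the statement with NO binder beyond the `H₂` predicate and the
field data:

* `natCard_selmer_eq_sq_of_tower` — **`#Sel_{2^M}(E_L/L) = (#Sel_{2^M}(E_L/L)^{σ})²` for every `M`**,
  hypotheses: `HasCM ∧ CMInert W 2 ∧ ρ̄_{E,2}` onto; `K` imaginary quadratic; `[L : K] = 2`, `L/ℚ` normal,
  `L` totally complex, `√d_F ∈ L`; `c₀` a complex conjugation (its transport restricted to `L` is `σ`).
  The `3`-cycle `z ∈ Γ_L` and the lift are cmk2's `exists_fixedPointFree_two_of_tower`,
  `restrictNormal_transport_mul_self`, `RatClosure.isLiftOfAut_restrictNormal_absGaloisTransport`.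
* `selmer_fixed_iff_exists_add_conjAct_of_tower` — on the same data, `Sel^{σ}`-classes (indeed all
  `σ_*`-fixed classes of `H¹(L, E_L[2^M])`) are of the form `y + σ_* y` (`Ĥ⁰(⟨σ⟩, H¹) = 0`).

This is the first Selmer-level EXACT splitting at `p = 2` in the tree with no displayed input
(MEMO §4 item 2: «instantiate p644904 on `Sel_{2^M}(E/L)` … first `Sel`-level exact splitting at `2`»).
beyond-print theorem: NO (Lang Ch. 10 §4 Remark; Milne *ADT* I.§7). BSD is not proved by any of this; no
summit statement is proved by this seat.

References: S. Lang, *Elliptic Functions* (1987), Ch. 10 §4 [Lang1987]; J. S. Milne, *Arithmetic Duality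
Theorems* (2006), I.§7 [MilneADT2006]; B. Gross, LMS LN 153 (1991), §9 [GrossLMS1991].
-/

set_option autoImplicit false

noncomputable section

open scoped Classical

namespace Summit.BirchSwinnertonDyer.Rank1Residual.P2.CMIsogenyAtTwo

open WeierstrassCurve Field NumberField
open Literature.NumberTheory.EllipticCurves Literature.NumberTheory.EllipticCurves.Rank1Residual
open Literature.NumberTheory.GaloisRepresentations
open Summit.BirchSwinnertonDyer.BirchSwinnertonDyer.Theorems.InertOrderSplittingHabitat

variable (W : WeierstrassCurve ℚ) [W.IsElliptic] {L : Type} [Field L] [NumberField L]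
variable {c₀ : absoluteGaloisGroup ℚ}

/-- **THE EXACT SELMER SPLITTING OVER THE TOWER, BINDER-FREE.** For `E/ℚ` with CM, `2` inert in the CM
field `F`, `ρ̄_{E,2}` onto; `K` imaginary quadratic; `L ⊇ K` with `[L : K] = 2`, normal over `ℚ`, totally
complex, `√d_F ∈ L`; `c₀` a complex conjugation, `σ = c₀|_L`: for every `M`,
`#Sel_{2^M}(E_L/L) = (#{x ∈ Sel_{2^M}(E_L/L) | σ_* x = x})²`. (cmk2's `natCard_selmer_eq_sq_of_tower`
with its input `hloc` discharged by `CMIsogenyAtTwo.natCard_selmer_eq_sq`: the CM generator is a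
`K`-isogeny.) [cite: Lang1987, Ch. 10 §4, Remark] [cite: MilneADT2006, I.§7] -/
theorem natCard_selmer_eq_sq_of_tower [Normal ℚ L] (hCM : W.HasCM) (hin : CMInert W 2)
    (hsurj : W.HasSurjectiveModNGaloisRep 2) (K : Type) [Field K] [NumberField K]
    (hK : IsImaginaryQuadratic K) [Algebra K L] (hLK : Module.finrank K L = 2)
    (hLc : ∀ w : InfinitePlace L, w.IsComplex) (hF : IsSquare (algebraMap ℚ L (cmFieldDiscrOfJ W.j)))
    (hc₀ : IsComplexConjugation (Rat.castHom ℝ) c₀) (M : ℕ) :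
    Nat.card (selmerGroup (W.baseChange L) ((2 : ℤ) ^ M)) =
      Nat.card {x : selmerGroup (W.baseChange L) ((2 : ℤ) ^ M) //
        conjAct W ((absGaloisTransport (K := ℚ) (L := L) c₀).restrictNormal L) _
          (x : galH1Torsion (W.baseChange L) ((2 : ℤ) ^ M)) = x} ^ 2 := by
  obtain ⟨z, hz⟩ := exists_fixedPointFree_two_of_tower W K hK.1 hsurj L hLK
  exact natCard_selmer_eq_sq W hCM hin hsurj hLc hF hc₀ (restrictNormal_transport_mul_self hc₀)
    (RatClosure.isLiftOfAut_restrictNormal_absGaloisTransport c₀) hz M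

/-- **`H¹(L, E_L[2^M])^{σ} = (1 + σ_*) H¹(L, E_L[2^M])` over the tower, binder-free**: on the same data,
a class is `σ_*`-fixed iff it is `y + σ_* y` for some `y`. [cite: Lang1987, Ch. 10 §4, Remark] -/
theorem fixed_iff_exists_add_conjAct_of_tower [Normal ℚ L] (hCM : W.HasCM) (hin : CMInert W 2)
    (hsurj : W.HasSurjectiveModNGaloisRep 2) (K : Type) [Field K] [NumberField K]
    (hK : IsImaginaryQuadratic K) [Algebra K L] (hLK : Module.finrank K L = 2)
    (hF : IsSquare (algebraMap ℚ L (cmFieldDiscrOfJ W.j)))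
    (hc₀ : IsComplexConjugation (Rat.castHom ℝ) c₀) (M : ℕ)
    (x : galH1Torsion (W.baseChange L) ((2 : ℤ) ^ M)) :
    conjAct W ((absGaloisTransport (K := ℚ) (L := L) c₀).restrictNormal L) _ x = x ↔
      ∃ y, x = y + conjAct W ((absGaloisTransport (K := ℚ) (L := L) c₀).restrictNormal L) _ y := by
  obtain ⟨z, hz⟩ := exists_fixedPointFree_two_of_tower W K hK.1 hsurj L hLK
  exact selmer_fixed_iff_exists_add_conjAct W hCM hin hsurj hF hc₀ (restrictNormal_transport_mul_self hc₀)
    (RatClosure.isLiftOfAut_restrictNormal_absGaloisTransport c₀) hz M x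

end Summit.BirchSwinnertonDyer.Rank1Residual.P2.CMIsogenyAtTwo
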